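import Summits.FinalStateConjecture.FinalStateConjecture.Theorems.BartnikGapSettlingBondiBartnikRigidityMarchingLemmaCollarSetBasic
import Summits.FinalStateConjecture.FinalStateConjecture.Theorems.BartnikGapSettlingBondiBartnikRigidityMarchingLemmaSlabPastGeometry
import Summits.FinalStateConjecture.FinalStateConjecture.Theorems.BartnikGapSettlingBondiBartnikRigidityStationaryKerrCollarRouteOriented
import Literature.Geometry.Lorentzian.CausalityClosure
import Literature.Geometry.Lorentzian.CauchyHypersurfaceGlobalHyperbolicity
import HarnessLib

/-!
# K2b-5 `stub_marchingLemma`, brick 14: the collar set is past-closed in closed form, and lies in the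
# boundary collar — line `direct-method-on-the-cone` (crux `BondiBartnikRigidity`, stmt-FinalStateConjecture-10807)

Continuation of `…MarchingLemmaCollarSetBasic` (same notation; `F` handed over by its membership predicate):

* `collarSet_pastClosed` — **`closure J⁻_K(x) ∩ W ⊆ F` for `x ∈ F`** (the "past-closed in closed form"
  hypothesis of `K2Route.ExactChartPastSet` for the domains `(W ∩ {t* < τ}) ∪ F` of the marching).  Proof:
  with the witness `s` of `x` (`T_{−s} x ∉ J⁺_K(slab)`) and `y ∈ closure J⁻_K(x) ∩ W`: if `T_{−s} y` is
  interior, a point `y⁻ ≪ y` close to `y` lies in `J⁻_K(x)` (push-up) with `T_{−s} y⁻ ∈ W`, and translating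
  the causal relation gives `T_{−s} x ∈ J⁺_K(W) ⊆ J⁺_K(slab)`, absurd; if `T_{−s} y` is a floor point, the
  witness `(s + η)/2` works for `y` (below a slab point `t* < 0`; below a roof point the vertical timelike
  segment would make the roof point interior);
* `collarSet_subset_collar` — `F ⊆ Δ_{1/2} ∪ (O ∩ W)` as soon as `O` contains the `η`-neighbourhood of the
  roof portion `∂J⁺_K(slab) ∩ {3M ≤ r ≤ ρ, t* ≤ w₀}` and the slab corner `{0 ≤ t* ≤ η, 3M − 2η ≤ r ≤ 3M}`;
* `mem_roofK_of_mem_frontier`, `isCompact_roofPortion` — the roof portion is a compact subset of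
  `roofK ∩ {r ≤ ρ}`.

References: Dafermos–Rodnianski arXiv:0811.0354, §5.1 [DafermosRodnianski2008]; O'Neill 1983, Ch. 14,
Cor. 14.1 [ONeill1983]; Hawking–Ellis 1973, §6.3 [HawkingEllis1973CUP].  No definitions, no named facts.
-/

noncomputable section

-- D-0017: single-problem summit, `Summit.<S>.<S>.…` by design (cf. lakefile `weak.linter.dupNamespace`).
set_option linter.dupNamespace false
set_option maxSynthPendingDepth 3

open Set Filter Function Topology TopologicalSpace Metric
open Literature.Geometry.Lorentzian
open scoped Manifold ContDiff Topology

namespace Summit.FinalStateConjecture.FinalStateConjecture.Theorems.BondiBartnikRigidity.DirectMethod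

namespace CollarK

open FutureK (translate_mem_region translate_translate_neg)
open K2Route (JKpast)

variable [Kerr.Facts] {M a : ℝ}

/-! ### The roof portion -/

/-- A frontier point of `J⁺_K(slab)` with `r ≥ 3M` is a roof point (`SlabFrontier`: it is a slab point —
then on `S₃` — or in `J⁺_K(S₃)`). [cite: HawkingEllis1973CUP, §6.3] -/
theorem mem_roofK_of_mem_frontier (hM : 0 < M)
    (hfr : frontier (JK M a hM (slabK M a)) ⊆ slabK M a ∪ JK M a hM (outerSphereK M a))
    {z : Kerr.region a M} (hz : z ∈ frontier (JK M a hM (slabK M a))) (hr : 3 * M ≤ Kerr.radius a z.1) :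
    z ∈ roofK M a hM := by
  refine ⟨hz, ?_⟩
  rcases hfr hz with h | h
  · exact LorentzianMetric.subset_causalFuture (Kerr.spacetime M a M hM.le).metric _ _ ⟨h.1, le_antisymm h.2 hr⟩
  · exact h

/-- **The roof portion `∂J⁺_K(slab) ∩ {3M ≤ r ≤ ρ, 0 ≤ t* ≤ w₀}` is compact.** [folklore] -/
theorem isCompact_roofPortion (hM : 0 < M) (ρ w₀ : ℝ) :
    IsCompact (frontier (JK M a hM (slabK M a)) ∩
      {y : Kerr.region a M | 0 ≤ y.1 0 ∧ y.1 0 ≤ w₀ ∧ 3 * M ≤ Kerr.radius a y.1 ∧ Kerr.radius a y.1 ≤ ρ}) := by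
  have h3 : max M 0 < 3 * M := by rw [max_eq_left hM.le]; linarith
  exact (PastK.isCompact_coordSlab (a := a) h3 0 w₀ ρ).of_isClosed_subset
    (isClosed_frontier.inter (PastK.isCompact_coordSlab (a := a) h3 0 w₀ ρ).isClosed) (fun y hy => hy.2)

/-! ### Push-up into the closure of a causal past, translation of the causal relation -/

/-- Every neighbourhood of `y` contains a point `y⁻` with `y ∈ I⁺_K(y⁻)` (a timelike curve through `y`).
[cite: ONeill1983, Ch. 5, p. 146] -/
theorem exists_mem_chronologicalFuture_of_mem_nhds (hM : 0 < M) (y : Kerr.region a M) {G : Set (Kerr.region a M)}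
    (hG : G ∈ 𝓝 y) :
    ∃ y' ∈ G, y ∈ (Kerr.smoothMetric M a M).chronologicalFuture ((Kerr.timeOrientation M a M hM.le).ofLE le_top) {y'} := by
  obtain ⟨μ, ε, hε, hμ0, hμ⟩ := LorentzianMetric.exists_isFutureTimelikeCurveOn_Ioo_of_isInteriorPoint
    (g := Kerr.smoothMetric M a M) (τ := (Kerr.timeOrientation M a M hM.le).ofLE le_top)
    (BoundarylessManifold.isInteriorPoint (I := 𝓘(ℝ, E4)) (x := y))
  have hc0 : ContinuousAt μ 0 := (hμ 0 ⟨by linarith, hε⟩).1.continuousAt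
  obtain ⟨δ₀, hδ₀, hball⟩ := Metric.mem_nhds_iff.1 (hc0.preimage_mem_nhds (by rw [hμ0]; exact hG))
  set δ := min δ₀ ε / 2 with hδ
  have hδp : 0 < δ := by positivity
  have hδ₁ : δ < δ₀ := by have := min_le_left δ₀ ε; rw [hδ]; linarith
  have hδ₂ : δ < ε := by have := min_le_right δ₀ ε; rw [hδ]; linarith
  refine ⟨μ (-δ), hball (by rw [Metric.mem_ball, dist_zero_right, norm_neg, Real.norm_eq_abs, abs_of_pos hδp]; exact hδ₁),
    μ (-δ), mem_singleton _, μ, -δ, 0, by linarith, hμ.mono fun t ht => ⟨by linarith [ht.1], by linarith [ht.2]⟩, rfl, hμ0⟩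

/-- **Push-up into the closure of a causal past**: `y ∈ closure J⁻_K(x)` and `y ∈ I⁺_K(y')` give
`y' ∈ J⁻_K(x)`. [cite: ONeill1983, Ch. 14, Cor. 14.1] -/
theorem mem_JKpast_of_mem_closure (hM : 0 < M) {x y y' : Kerr.region a M} (hy : y ∈ closure (JKpast M a hM {x}))
    (hyy' : y ∈ (Kerr.smoothMetric M a M).chronologicalFuture ((Kerr.timeOrientation M a M hM.le).ofLE le_top) {y'}) :
    y' ∈ JKpast M a hM {x} := by
  have hn1 : (1 : ℕ∞ω) ≤ ((⊤ : ℕ∞) : ℕ∞ω) := by exact_mod_cast le_top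
  have hopen := LorentzianMetric.isOpen_chronologicalFuture_of_boundaryless (Kerr.smoothMetric M a M)
    ((Kerr.timeOrientation M a M hM.le).ofLE le_top) {y'}
  obtain ⟨z, hzI, hzJ⟩ := mem_closure_iff.1 hy _ hopen hyy'
  rw [PastK.mem_JKpast_singleton_iff hM, FrontierK.JK_eq] at hzJ ⊢
  exact LorentzianMetric.chronologicalFuture_subset_causalFuture _ _ _
    (LorentzianMetric.mem_chronologicalFuture_of_mem_chronologicalFuture_of_mem_causalFuture_set hn1 hzI hzJ)

/-- **Translation of the causal relation**: `y' ∈ J⁻_K(x) ⇒ T_c y' ∈ J⁻_K(T_c x)`. [cite: ONeill1983, Ch. 14, p. 402] -/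
theorem translate_mem_JKpast (hM : 0 < M) {x y' : Kerr.region a M} (h : y' ∈ JKpast M a hM {x}) (c : ℝ) :
    (⟨(y' : E4) + c • E4.basisVector 0, translate_mem_region y' c⟩ : Kerr.region a M) ∈
      JKpast M a hM {⟨(x : E4) + c • E4.basisVector 0, translate_mem_region x c⟩} := by
  rw [PastK.mem_JKpast_singleton_iff hM] at h ⊢
  have := FutureK.translate_mem_JK_of_mem hM h c
  rwa [image_singleton] at this

/-! ### Past-closedness in closed form -/

/-- **The collar set is past-closed in `W`, in closed form** (see the module docstring).
[cite: DafermosRodnianski2008, §5.1] -/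
theorem collarSet_pastClosed (hM : 0 < M) (ha : |a| < M)
    (hcyl : {y : Kerr.region a M | 0 ≤ y.1 0 ∧ Kerr.radius a y.1 ≤ 3 * M} ⊆ JK M a hM (slabK M a))
    (hfr : frontier (JK M a hM (slabK M a)) ⊆ slabK M a ∪ JK M a hM (outerSphereK M a))
    {F : Set (Kerr.region a M)} {w₀ η : ℝ}
    (hF : ∀ x : Kerr.region a M, x ∈ F ↔ x ∈ interior (JK M a hM (slabK M a)) ∧
      x.1 0 + 2 / 3 * Kerr.radius a x.1 < w₀ ∧ ∃ s, 0 < s ∧ s < η ∧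
        (⟨x.1 + (-s) • E4.basisVector 0, translate_mem_region x (-s)⟩ : Kerr.region a M) ∉ JK M a hM (slabK M a))
    {x : Kerr.region a M} (hx : x ∈ F) :
    closure (JKpast M a hM {x}) ∩ interior (JK M a hM (slabK M a)) ⊆ F := by
  rintro y ⟨hyc, hyW⟩
  obtain ⟨-, hxw, s, hs0, hsη, hs⟩ := (hF x).1 hx
  have hJc := FutureK.isClosed_JK_slabK hM hfr
  obtain ⟨-, hclock, -⟩ := PastK.closure_JKpast_subset hM ha x hyc
  have hyw : y.1 0 + 2 / 3 * Kerr.radius a y.1 < w₀ := lt_of_le_of_lt hclock hxw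
  set T : ℝ → Kerr.region a M → Kerr.region a M := fun c z => ⟨z.1 + c • E4.basisVector 0, translate_mem_region z c⟩
    with hT
  by_cases hmem : T (-s) y ∈ JK M a hM (slabK M a)
  swap
  · exact (hF y).2 ⟨hyW, hyw, s, hs0, hsη, hmem⟩
  by_cases hint : T (-s) y ∈ interior (JK M a hM (slabK M a))
  · -- interior: push-up and translate
    exfalso
    have hG : T (-s) ⁻¹' interior (JK M a hM (slabK M a)) ∈ 𝓝 y :=
      (continuous_translate.comp (Continuous.prodMk_right (-s))).continuousAt.preimage_mem_nhds
        (isOpen_interior.mem_nhds hint)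
    obtain ⟨y', hy'G, hyy'⟩ := exists_mem_chronologicalFuture_of_mem_nhds hM y hG
    have h1 := translate_mem_JKpast hM (mem_JKpast_of_mem_closure hM hyc hyy') (-s)
    rw [PastK.mem_JKpast_singleton_iff hM] at h1
    have hn2 : (2 : ℕ∞ω) ≤ ((⊤ : ℕ∞) : ℕ∞ω) := WithTop.coe_le_coe.mpr le_top
    have h2 := LorentzianMetric.causalFuture_mono (g := (Kerr.spacetime M a M hM.le).metric)
      (τ := (Kerr.spacetime M a M hM.le).timeOrientation) (singleton_subset_iff.2 (interior_subset hy'G)) h1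
    rw [show (Kerr.spacetime M a M hM.le).metric.causalFuture (Kerr.spacetime M a M hM.le).timeOrientation
      (JK M a hM (slabK M a)) = JK M a hM (slabK M a) from LorentzianMetric.causalFuture_causalFuture_holds _ _ hn2 _] at h2
    exact hs h2
  · -- floor point
    have hfront : T (-s) y ∈ frontier (JK M a hM (slabK M a)) := by
      rw [hJc.frontier_eq]; exact ⟨hmem, hint⟩
    refine (hF y).2 ⟨hyW, hyw, (s + η) / 2, by linarith, by linarith, fun hmem' => ?_⟩
    rcases hfr hfront with hslab | hS3
    · -- below a slab point `t* < 0`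
      have h0 : (T (-s) y).1 0 = 0 := hslab.1
      have h0' : y.1 0 = s := by
        have : (T (-s) y).1 0 = y.1 0 - s := by simp [hT, E4.basisVector]; ring
        linarith
      have h := (FrontierK.JK_slabK_subset hM ha hmem').1
      have : (y.1 + (-((s + η) / 2)) • E4.basisVector 0) 0 = y.1 0 - (s + η) / 2 := by simp [E4.basisVector]; ring
      have h' : 0 ≤ (y.1 + (-((s + η) / 2)) • E4.basisVector 0) 0 := h
      rw [this, h0'] at h'
      linarith
    · -- below a roof point: the roof point would be interior
      have hroof : T (-s) y ∈ roofK M a hM := ⟨hfront, hS3⟩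
      have h := translate_neg_notMem_of_mem_roofK hM ha hcyl hroof (c := (η - s) / 2) (by linarith)
      apply h
      show T (-((η - s) / 2)) (T (-s) y) ∈ _
      rw [show T (-((η - s) / 2)) (T (-s) y) = T (-((s + η) / 2)) y from by
        rw [hT]; simp only; rw [translate_translate]; congr 2; ring]
      exact hmem'

/-! ### The collar set lies in the boundary collar -/

/-- **`F ⊆ Δ_{1/2} ∪ (O ∩ W)`** once `O` contains the `η`-neighbourhood of the roof portion and the slab
corner, and `w < w₀` forces `r ≤ ρ`, `t* ≤ w₀` (see the module docstring). [cite: DafermosRodnianski2008, §5.1] -/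
theorem collarSet_subset_collar (hM : 0 < M) (ha : |a| < M)
    (hcyl : {y : Kerr.region a M | 0 ≤ y.1 0 ∧ Kerr.radius a y.1 ≤ 3 * M} ⊆ JK M a hM (slabK M a))
    (hfr : frontier (JK M a hM (slabK M a)) ⊆ slabK M a ∪ JK M a hM (outerSphereK M a))
    {F : Set (Kerr.region a M)} {w₀ η ρ : ℝ} (hρ : 3 / 2 * w₀ ≤ ρ)
    (hF : ∀ x : Kerr.region a M, x ∈ F ↔ x ∈ interior (JK M a hM (slabK M a)) ∧
      x.1 0 + 2 / 3 * Kerr.radius a x.1 < w₀ ∧ ∃ s, 0 < s ∧ s < η ∧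
        (⟨x.1 + (-s) • E4.basisVector 0, translate_mem_region x (-s)⟩ : Kerr.region a M) ∉ JK M a hM (slabK M a))
    {O : Set (Kerr.region a M)}
    (hOroof : ∀ x z : Kerr.region a M, z ∈ frontier (JK M a hM (slabK M a)) → 0 ≤ z.1 0 → z.1 0 ≤ w₀ →
      3 * M ≤ Kerr.radius a z.1 → Kerr.radius a z.1 ≤ ρ → dist x z < η → x ∈ O)
    (hOslab : ∀ x : Kerr.region a M, 0 ≤ x.1 0 → x.1 0 ≤ η → 3 * M - 2 * η ≤ Kerr.radius a x.1 →
      Kerr.radius a x.1 ≤ 3 * M → x ∈ O) :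
    F ⊆ K2Route.slabDiamondHalfK M a ∪ (O ∩ interior (JK M a hM (slabK M a))) := by
  intro x hx
  obtain ⟨hxW, hxw, -⟩ := (hF x).1 hx
  obtain ⟨s', hs'0, hs'η, -, hfront⟩ := collarSet_floor hM ha hcyl hfr hF hx
  have hx0 := FutureK.interior_JK_slabK_pos hM ha hxW
  have hxr : M < Kerr.radius a x.1 := Kerr.lt_radius_of_mem_region x.2
  set z : Kerr.region a M := ⟨x.1 + (-s') • E4.basisVector 0, translate_mem_region x (-s')⟩ with hz
  have hzt : z.1 0 = x.1 0 - s' := by simp [hz, E4.basisVector]; ring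
  have hzr : Kerr.radius a z.1 = Kerr.radius a x.1 := Kerr.radius_add_time_smul_basisVector a x.1 _
  have hdist : dist x z = s' := by
    rw [Subtype.dist_eq, dist_eq_norm]
    show ‖x.1 - (x.1 + (-s') • E4.basisVector 0)‖ = s'
    rw [show x.1 - (x.1 + (-s') • E4.basisVector 0) = s' • E4.basisVector 0 by module, norm_smul,
      Real.norm_eq_abs, abs_of_nonneg hs'0]
    simp [E4.basisVector]
  have hz0 : 0 ≤ z.1 0 := (FrontierK.JK_slabK_subset hM ha
    ((FutureK.isClosed_JK_slabK hM hfr).closure_subset (frontier_subset_closure hfront))).1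
  rcases hfr hfront with hslab | hS3
  · -- floor = slab: `t*(x) = s' < η`, `r(x) ≤ 3M`
    have ht : x.1 0 = s' := by have : z.1 0 = 0 := hslab.1; linarith
    have hr3 : Kerr.radius a x.1 ≤ 3 * M := by rw [← hzr]; exact hslab.2
    by_cases hin : Kerr.radius a x.1 < 3 * M - 2 * η
    · exact Or.inl ⟨hx0, by linarith⟩
    · push Not at hin
      exact Or.inr ⟨hOslab x hx0.le (by linarith) hin hr3, hxW⟩
  · -- floor = roof
    have hr3 := radius_ge_of_mem_roofK hM ha hcyl ⟨hfront, hS3⟩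
    rw [hzr] at hr3
    refine Or.inr ⟨hOroof x z hfront hz0 (by rw [hzt]; nlinarith [Kerr.radius_nonneg a x.1]) (by rw [hzr]; exact hr3)
      (by rw [hzr]; nlinarith) (by rw [hdist]; exact hs'η), hxW⟩

end CollarK

/-- **Registered bookkeeping sub-goal `stub_kerrRoofPortionCompact` of the line** (brick of the landing of
K2b-5 `stub_marchingLemma`): the roof portion `∂J⁺_K(slab) ∩ {3M ≤ r ≤ ρ, 0 ≤ t* ≤ w₀}` of the Kerr star
chart is compact (anchor of this file, whose content is the closed-form past-closedness of the collar set
`CollarK.collarSet_pastClosed` and `CollarK.collarSet_subset_collar`). [folklore] -/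
theorem stub_kerrRoofPortionCompact [Kerr.Facts] : ∀ (M a : ℝ) (hM : 0 < M) (ρ w₀ : ℝ),
    IsCompact (frontier (JK M a hM (slabK M a)) ∩
      {y : Kerr.region a M | 0 ≤ y.1 0 ∧ y.1 0 ≤ w₀ ∧ 3 * M ≤ Kerr.radius a y.1 ∧ Kerr.radius a y.1 ≤ ρ}) :=
  fun _ _ hM ρ w₀ => CollarK.isCompact_roofPortion hM ρ w₀

end Summit.FinalStateConjecture.FinalStateConjecture.Theorems.BondiBartnikRigidity.DirectMethod

end
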